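import Summits.BirchSwinnertonDyer.BirchSwinnertonDyer.Theses.LeadingTerm
import Literature.NumberTheory.EllipticCurves.CongruentNumberOne
import Literature.NumberTheory.EllipticCurves.BSDAnalyticRankTunnellCMProofs
import Literature.NumberTheory.EllipticCurves.CongruentNumberCurveSupersingular
import Literature.NumberTheory.EllipticCurves.ComplexMultiplicationLocalFactorsAux
import Literature.NumberTheory.EllipticCurves.ModularSymbolsProofs
import Literature.NumberTheory.EllipticCurves.ModularSymbolsNormalizedSymbolProofs

/-!
# Disproof of `Consistency` (stmt-BirchSwinnertonDyer-16217) — crux-disprover work-file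

Seat refuter-cdisprove-stmt-BirchSwinnertonDyer-16217-0, cycle 1 (2026-08-16). Route
`LeadingTerm`; crux #2 `Consistency` (leading-term consistency at the ALGEBRAIC rank).

## Findings (index)

* **No kill. The crux resists every Lean-landable attack for a STRUCTURAL reason (O1) and is a
  consequence of standard conjectures on paper (§2); numerics agree (§3).**
* (O1) `Consistency = ∀ W p D N f, [W elliptic, globally minimal; p ≥ 5 prime good ordinary;
  D canonical; IsNewformOf W f] → 0 < Reg_∞ ∧ 0 < Ω⁺_f ∧ ∃ q ∈ ℚ, (A) ∧ (P)`. An unconditional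
  `¬ Consistency` must EXHIBIT `(W, p, D, N, f)` together with a PROOF of `IsNewformOf W f`, i.e.
  modularity of one explicit curve with its explicit newform. The tree has no such instance
  (`exists_isNewformOf` is an unproved named fact; `congruentCuspForm32` is a genuine cusp form but
  `IsNewformOf (congruentNumberCurve 1) congruentCuspForm32` is not proved). Every refutation,
  however the analytic values behave, is blocked at this antecedent.
* (O2) Even given a newform instance, refuting `(A) ∧ (P)` needs CERTIFIED VALUES of
  `L^{(r)}(E,1)`, `Ω⁺_f`, `Reg_∞`, `[T^r]L_p`, `Reg_p` — all defined by `limUnder`/`tsum`/Bochner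
  integrals/`Classical.choose` with no in-tree evaluator; only vanishing/junk regimes are
  computable (§4: `padicLFunction f 0 = 0`, `plusPeriod 0 = 0`, `unitRoot = 0` off ordinary).
* §2 TRUTH STATUS. Inside the tree's own conventions (`PAdicBSD.lean` normalisation table):
  `Consistency(E,p)` ⇐ BSD leading-term formula at index `r_an = r_MW` ∧
  `PAdicBSDConjecture`(ii)`(E,p,D_can)` ∧ `Ш` finite ∧ `Ω⁺_f = ϖ Ω_E`, `ϖ ∈ ℚ`: the SAME
  `q = (#Ш·Tam/#tors²)/ϖ` solves (A) (`L^{(r)} = r!·q·Ω⁺_f·Reg_∞`) and (P)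
  (`[T^r]L_p·log_p(γ)^r = q·(1−α⁻¹)²·Reg_p`, verbatim the shape of `PAdicBSDConjecture` divided
  by `ϖ·#tors²`). So the crux is not refutable by known mathematics; its content beyond the two
  conjectures is the thesis' transfer `r_an ≤ r_MW` at a pinch prime (route docstring), and beyond
  KNOWN results it is open exactly from `r_MW = 2` on (rank-2 `p`-adic Beilinson, BKS
  arXiv:1910.07404 Conj. 1.1 / Cor. 1.10, stated there only under `r_an = r_MW`).
* §3 NUMERICS (kit compute jobs j020759, script `compute/consistency_check2.gp`, PARI/GP
  `msfromell/mspadicmoments/mspadicL`, `ellpadicregulator`; PARI's documented canonical height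
  `log_p(den x(P)) − 2 log_p σ(P)` (σ for `s₂ = ellpadics2`) is LITERALLY the tree's
  `canonicalPAdicHeight`, its `log` is the Iwasawa branch, and `L_p^{(r)}(χ⁰) = ∫ log_p^r dμ`, so
  `L_p^{(r)}(χ⁰)/r! = [T^r]L_p · log_p(γ)^r`): `q_∞ := L^{(r)}(E,1)/(r!·Ω_E·Reg_∞)` versus
  `q_p := (L_p^{(r)}(0)/r!)/((1−α⁻¹)²·Reg_p)` — see the `Numerics` docstring at the end of this
  file for the table (filled from the job log). Agreement `q_∞ = q_p = Tam/tors²` at rank 1 and 2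
  is the planner's "cheapest falsifier" (389a1) actually run.
* §4 LOAD-BEARING HYPOTHESES (drop one at a time):
  - `IsNewformOf W f`: LOAD-BEARING — `f = 0` has `Ω⁺_0 = 0`. PROVED below and LANDED as
    `Theorems/Consistency/Negative/ConsistencyFalseWithoutNewform.lean` (p130747,
    `consistency_false_without_newform`).
  - `D.IsCanonical`: LOAD-BEARING in rank ≥ 1 (zero datum ⇒ `Reg_p = 0` ⇒ (P) forces
    `[T^{r_MW}]L_p = 0` at every good ordinary `p`, false at (37a1, 5): `[T¹]L_5 ≠ 0`, §3), but
    NOT Lean-refutable (O1+O2). VACUOUS in rank 0: on `E₁ = 32a2` EVERY datum is canonical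
    (`isCanonical_congruentNumberCurve_one`) — harmless only because `Reg_p = det ∅ = 1` there.
    Near-miss `consistency_false_without_canonical` (sorry, obstruction in its docstring).
  - `IsOrdinaryAt W p`: LOAD-BEARING THROUGH JUNK: at supersingular `p`, `unitRoot W p = 0`
    (`unitRoot_eq_zero_of_dvd`), `(1 − 0⁻¹)² = 1` and `padicLFunction f 0 = 0`
    (`padicLFunction_zero_root`), so (P) reads `0 = q · Reg_p(D)`; on a rank-0 curve `Reg_p = 1`
    forces `q = 0`, and then (A) says `L(E,1) = 0` — false at (32a2, p = 7) but needs the newform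
    of 32a2 and `L(E₁,1) ≠ 0` in Lean (O1, O2). Near-miss `consistency_false_without_ordinary`.
  - `5 ≤ p`: CONVENIENCE, not load-bearing for truth: `p = 3` good ordinary is MTT's conjecture as
    well (expected true); it matches the `p ≥ 5` hypotheses of `exists_isCanonical` /
    `exists_admissible_nsmul`. `p = 2` would need the `γ = 5`, `e₀ = 2` conventions (present in
    `PAdicLFunction`) and a 2-adic sigma function (absent). Information for the prover only.
  - `[W.IsGloballyMinimal]`: needed to TYPE `IsOrdinaryAt/unitRoot/frobeniusTrace` and for the
    sigma formula (`x.den` of the minimal model); `mordellWeilRank`, `entireLFunction`, `regulator`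
    are isomorphism invariants (route `closes`, T1–T3). Not droppable syntactically.
  - `[W.IsElliptic]`: for singular `W` Mathlib's `Point` is the group of NONSINGULAR points
    (`𝔾_a` or `𝔾_m`-type), `regulator` is junk `0`, so the conjunct `0 < W.regulator` fails — but
    again only behind a (meaningless) `IsNewformOf W f`. Not informative.
* §5 NATURAL STRENGTHENINGS. (S1) "for ALL data `D`" — false in reality in rank ≥ 1 (§4), do not
  strengthen. (S2) "`q` independent of `p` and of `D`" — PREDICTED TRUE (`q = #Ш·Tam/#tors²/ϖ`);
  a prover may as well aim for it. (S3) "`q ≠ 0`" — that is LB_∞ itself (open). (S4) the same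
  identity at an index `k < r_MW` — both sides vanish iff `ord_T L_p > k` and `L^{(k)}(E,1) = 0`;
  at `k < r_MW ≤ ord_T L_p` (Kato) the `p`-adic side is `0`, so it would assert `L^{(k)}(E,1) = 0`
  for `k < r_MW`, i.e. `r_MW ≤ r_an` (= SqueezeUBR2): a DIFFERENT crux, not a strengthening to add.
* §6 WHY IT RESISTS / what a proof must contain (for provers): `r_MW = 0`: MSD interpolation
  (`isPAdicLFunctionOf_padicLFunction`) + `[0]⁺ = L(f,1)/Ω⁺ ∈ ℚ` (Manin–Drinfeld,
  `ratCast_ratPlusSymbol`) + `entireLFunction W 1 = L(f,1)` + `Reg_∞ = Reg_p = 1`; `r_MW = 1 = r_an`: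
  Perrin-Riou's `p`-adic Gross–Zagier against Gross–Zagier (support item RankLeOne);
  `r_MW = 1 < r_an`: ALREADY the transfer problem (needs `[T¹]L_p = 0 ⇐ L'(E,1) = 0`, unknown);
  `r_MW ≥ 2`: rank-2 `p`-adic Beilinson + transfer. Targets: none yet (payload.targets empty).
-/

noncomputable section

open scoped Classical
open Filter Topology
open WeierstrassCurve CongruenceSubgroup
open Literature.NumberTheory.EllipticCurves Literature.NumberTheory.EllipticCurves.ModularForms

namespace Summit.BirchSwinnertonDyer.BirchSwinnertonDyer.Cruxes.Consistency.Disproof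

/-! ## §A  Load-bearing analysis: `IsNewformOf` (PROVED, landed p130747) -/

/-- The crux with the hypothesis `IsNewformOf W f` dropped (everything else verbatim). -/
def ConsistencyWithoutNewform : Prop :=
  ∀ (W : WeierstrassCurve ℚ) [W.IsElliptic] [W.IsGloballyMinimal] (p : ℕ) [Fact p.Prime], 5 ≤ p → Literature.NumberTheory.EllipticCurves.IsOrdinaryAt W p → ∀ (D : WeierstrassCurve.PAdicHeightData W p), D.IsCanonical → ∀ ⦃N : ℕ⦄ [NeZero N] (f : CuspForm (CongruenceSubgroup.Gamma0 N) 2), 0 < W.regulator ∧ 0 < Literature.NumberTheory.EllipticCurves.ModularForms.plusPeriod f ∧ ∃ q : ℚ, iteratedDeriv W.mordellWeilRank W.entireLFunction 1 = (((W.mordellWeilRank.factorial : ℝ) * (q : ℝ) * Literature.NumberTheory.EllipticCurves.ModularForms.plusPeriod f * W.regulator : ℝ) : ℂ) ∧ PowerSeries.coeff W.mordellWeilRank (Literature.NumberTheory.EllipticCurves.padicLFunction f (Literature.NumberTheory.EllipticCurves.unitRoot W p : ℚ_[p])) * Literature.NumberTheory.EllipticCurves.padicLog p (Literature.NumberTheory.EllipticCurves.cyclotomicGenerator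 p) ^ W.mordellWeilRank = (q : ℚ_[p]) * (1 - (Literature.NumberTheory.EllipticCurves.unitRoot W p : ℚ_[p])⁻¹) ^ 2 * WeierstrassCurve.padicRegulator D

/-- Sanity: `Consistency` is literally `ConsistencyWithoutNewform` guarded by `IsNewformOf`. -/
theorem consistency_of_withoutNewform (h : ConsistencyWithoutNewform) :
    Summit.BirchSwinnertonDyer.BirchSwinnertonDyer.Theses.LeadingTerm.Consistency :=
  fun W _ _ p _ h5 hord D hD _ _ f _ => h W p h5 hord D hD f

/-- The zero cusp form has all cusp-to-cusp periods `0`. [folklore] -/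
theorem cuspSymbol_zero (N : ℕ) (γ : Gamma0 N) : cuspSymbol (0 : CuspForm (Gamma0 N) 2) γ = 0 := by
  have h := cuspSymbol_smul (0 : ℂ) (0 : CuspForm (Gamma0 N) 2) γ
  rwa [zero_smul, zero_mul] at h

/-- `Λ_0 = ⊥`. [folklore] -/
theorem periodLattice_zero (N : ℕ) : periodLattice (0 : CuspForm (Gamma0 N) 2) = ⊥ := by
  rw [periodLattice, AddSubgroup.closure_eq_bot_iff]
  rintro _ ⟨γ, rfl⟩
  exact cuspSymbol_zero N γ

/-- `re Λ_0 = ⊥`. [folklore] -/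
theorem realPeriods_zero (N : ℕ) : realPeriods (0 : CuspForm (Gamma0 N) 2) = ⊥ := by
  rw [realPeriods, periodLattice_zero, AddSubgroup.map_bot]

/-- **`Ω⁺_0 = 0`** (junk branch of `plusPeriod`). [folklore] -/
theorem plusPeriod_zero (N : ℕ) : plusPeriod (0 : CuspForm (Gamma0 N) 2) = 0 := by
  rcases plusPeriod_eq_zero_or (0 : CuspForm (Gamma0 N) 2) with h | ⟨hpos, heq⟩
  · exact h
  · exfalso
    rw [realPeriods_zero] at heq
    have hmem : plusPeriod (0 : CuspForm (Gamma0 N) 2) / 2 ∈ (⊥ : AddSubgroup ℝ) := by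
      rw [heq]; exact AddSubgroup.mem_zmultiples _
    rw [AddSubgroup.mem_bot] at hmem
    linarith

/-- `#Ẽ₁(𝔽₅) = 8` for `E₁ : y² = x³ − x`. [folklore] -/
theorem numPointsMod_congruentNumberCurveInt_one_five :
    Literature.NumberTheory.Automorphic.numPointsMod (congruentNumberCurveInt 1) 5 = 8 := by
  unfold Literature.NumberTheory.Automorphic.numPointsMod
  rw [map_congruentNumberCurveInt, natCard_point_eq_one_add_card _ (by decide)]
  decide

/-- `5 ∤ a₅(E₁) = −2`. [folklore] -/
theorem not_five_dvd_frobeniusTrace_congruentNumberCurve_one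
    [(congruentNumberCurve 1).IsGloballyMinimal] :
    ¬ (5 : ℤ) ∣ (congruentNumberCurve 1).frobeniusTrace 5 := by
  rw [frobeniusTrace_congruentNumberCurve 1 5, Literature.NumberTheory.Automorphic.frobeniusTrace,
    numPointsMod_congruentNumberCurveInt_one_five]
  decide

/-- `E₁` is good ordinary at `5`. [folklore] -/
theorem isOrdinaryAt_congruentNumberCurve_one_five [Fact (Nat.Prime 5)]
    [(congruentNumberCurve 1).IsGloballyMinimal] : IsOrdinaryAt (congruentNumberCurve 1) 5 :=
  ⟨hasGoodReductionAtPrime_congruentNumberCurve (by norm_num),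
    not_five_dvd_frobeniusTrace_congruentNumberCurve_one⟩

/-- RANK-0 VACUITY of `IsCanonical`: if every rational point is torsion, EVERY height datum is
canonical (the predicate only constrains admissible = non-torsion points). [folklore] -/
theorem isCanonical_of_forall_isOfFinAddOrder {W : WeierstrassCurve ℚ} {p : ℕ} [Fact p.Prime]
    (h : ∀ P : W.toAffine.Point, IsOfFinAddOrder P) (D : PAdicHeightData W p) : D.IsCanonical :=
  fun P hP => absurd (h P) hP.1

/-- On `E₁ = 32a2` (`E₁(ℚ) = E₁[2]`, Fermat) every datum is canonical, for every `p`. [folklore] -/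
theorem isCanonical_congruentNumberCurve_one (p : ℕ) [Fact p.Prime]
    (D : PAdicHeightData (congruentNumberCurve 1) p) : D.IsCanonical :=
  isCanonical_of_forall_isOfFinAddOrder (fun P => (isOfFinAddOrder_iff_nsmul_eq_zero).mpr
    ⟨2, two_pos, two_nsmul_point_congruentNumberCurve_one P⟩) D

/-- **Any proof of `Consistency` must use `IsNewformOf W f`.** Witness `(E₁, p = 5, zero datum,
N = 1, f = 0)`: `Ω⁺_0 = 0` kills `0 < Ω⁺_f`. LANDED as
`Summit.BirchSwinnertonDyer.BirchSwinnertonDyer.Theorems.consistency_false_without_newform`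
(Theorems/Consistency/Negative/ConsistencyFalseWithoutNewform.lean, p130747). [folklore] -/
theorem consistency_false_without_newform : ¬ ConsistencyWithoutNewform := by
  intro h
  haveI : Fact (Nat.Prime 5) := ⟨by norm_num⟩
  haveI : (congruentNumberCurve 1).IsElliptic := isElliptic_congruentNumberCurve one_ne_zero
  haveI : (congruentNumberCurve 1).IsGloballyMinimal :=
    isGloballyMinimal_congruentNumberCurve squarefree_one
  obtain ⟨-, hΩ, -⟩ := h (congruentNumberCurve 1) 5 le_rfl isOrdinaryAt_congruentNumberCurve_one_five
    ⟨0, fun _ _ => rfl, fun _ _ _ => rfl⟩ (isCanonical_congruentNumberCurve_one 5 _) (N := 1)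
    (0 : CuspForm (CongruenceSubgroup.Gamma0 1) 2)
  rw [plusPeriod_zero] at hΩ
  exact lt_irrefl _ hΩ

/-! ## §B  Junk regimes off the hypotheses (PROVED): what `IsOrdinaryAt` protects against -/

/-- At a prime `p ∣ a_p` (supersingular, or bad with `a_p = 0`) the Hecke polynomial
`X² − a_p X + p` has NO unit root in `ℤ_p` (`α² = a_pα − p ∈ pℤ_p`), so the tree's `unitRoot W p`
takes its junk value `0`. [folklore] -/
theorem unitRoot_eq_zero_of_dvd (W : WeierstrassCurve ℚ) [W.IsGloballyMinimal] (p : ℕ)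
    [Fact p.Prime] (h : (p : ℤ) ∣ W.frobeniusTrace p) : unitRoot W p = 0 := by
  unfold unitRoot
  rw [dif_neg]
  rintro ⟨α, ⟨hα, hu⟩, -⟩
  obtain ⟨c, hc⟩ := h
  have hp : (p : ℤ_[p]) ∈ IsLocalRing.maximalIdeal ℤ_[p] := by
    rw [PadicInt.maximalIdeal_eq_span_p]; exact Ideal.mem_span_singleton_self _
  have hsq : α * α ∈ IsLocalRing.maximalIdeal ℤ_[p] := by
    have e : α * α = (p : ℤ_[p]) * ((c : ℤ_[p]) * α - 1) := by
      have : (W.frobeniusTrace p : ℤ_[p]) = (p : ℤ_[p]) * (c : ℤ_[p]) := by exact_mod_cast hc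
      linear_combination hα + α * this
    rw [e]; exact Ideal.mul_mem_right _ _ hp
  have hα' : α ∈ IsLocalRing.maximalIdeal ℤ_[p] :=
    ((IsLocalRing.maximalIdeal.isMaximal ℤ_[p]).isPrime.mem_or_mem hsq).elim id id
  exact (IsLocalRing.mem_maximalIdeal α).mp hα' hu

/-- The MSD measure against the junk root `α = 0` vanishes at every level `≥ 1` (`0⁻¹ = 0`).
[folklore] -/
theorem msdMeasure_zero_root {N : ℕ} (f : CuspForm (Gamma0 N) 2) {p : ℕ} [Fact p.Prime]
    {m : ℕ} (hm : 0 < m) (a : ZMod (p ^ m)) : msdMeasure f (0 : ℚ_[p]) m a = 0 := by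
  obtain ⟨k, rfl⟩ := Nat.exists_eq_succ_of_ne_zero hm.ne'
  simp [msdMeasure]

/-- Hence every Riemann sum, every coefficient, and the whole power series `L_p(f, 0, T)` vanish:
off the ordinary locus the crux's `p`-adic side is the junk identity `0 = q · 1 · Reg_p(D)`.
[folklore] -/
theorem padicLFunction_zero_root {N : ℕ} (f : CuspForm (Gamma0 N) 2) {p : ℕ} [Fact p.Prime] :
    padicLFunction f (0 : ℚ_[p]) = 0 := by
  have hsum : ∀ k n, padicLRiemannSum f (0 : ℚ_[p]) k n = 0 := by
    intro k n
    have hpos : 0 < n + cyclotomicExponent p := by unfold cyclotomicExponent; split_ifs <;> omega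
    simp [padicLRiemannSum, msdMeasure_zero_root f hpos]
  have hcoeff : ∀ k, padicLCoeff f (0 : ℚ_[p]) k = 0 := by
    intro k
    have : padicLRiemannSum f (0 : ℚ_[p]) k = fun _ => 0 := funext (hsum k)
    rw [padicLCoeff, this]
    exact tendsto_const_nhds.limUnder_eq
  ext k
  simp [coeff_padicLFunction, hcoeff]

/-! ## §C  Near-misses (sorry; obstruction recorded) -/

/-- The crux with `D.IsCanonical` dropped. FALSE in reality in rank ≥ 1 (take the zero datum:
`Reg_p = 0`, so (P) forces `[T^{r_MW}]L_p(f,α) = 0` at EVERY good ordinary `p`, contradicted by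
`[T¹]L_5(37a1) ≠ 0`, job j020759) — but a Lean proof needs (O1) the newform of 37a1 and (O2) a
certified non-vanishing of a `limUnder`-defined coefficient. In rank 0 the dropped hypothesis is
vacuous anyway. [folklore] -/
def ConsistencyWithoutCanonical : Prop :=
  ∀ (W : WeierstrassCurve ℚ) [W.IsElliptic] [W.IsGloballyMinimal] (p : ℕ) [Fact p.Prime], 5 ≤ p → Literature.NumberTheory.EllipticCurves.IsOrdinaryAt W p → ∀ (D : WeierstrassCurve.PAdicHeightData W p), ∀ ⦃N : ℕ⦄ [NeZero N] (f : CuspForm (CongruenceSubgroup.Gamma0 N) 2), Literature.NumberTheory.EllipticCurves.ModularForms.IsNewformOf W f → 0 < W.regulator ∧ 0 < Literature.NumberTheory.EllipticCurves.ModularForms.plusPeriod f ∧ ∃ q : ℚ, iteratedDeriv W.mordellWeilRank W.entireLFunction 1 = (((W.mordellWeilRank.factorial : ℝ) * (q : ℝ) * Literature.NumberTheory.EllipticCurves.ModularForms.plusPeriod f * W.regulator : ℝ) : ℂ) ∧ PowerSeries.coeff W.mordellWeilRank (Literature.NumberTheory.EllipticCurves.padicLFunction f (Literature.NumberTheory.EllipticCurves.unitRoot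 W p : ℚ_[p])) * Literature.NumberTheory.EllipticCurves.padicLog p (Literature.NumberTheory.EllipticCurves.cyclotomicGenerator p) ^ W.mordellWeilRank = (q : ℚ_[p]) * (1 - (Literature.NumberTheory.EllipticCurves.unitRoot W p : ℚ_[p])⁻¹) ^ 2 * WeierstrassCurve.padicRegulator D

/-- NEAR-MISS: `¬ ConsistencyWithoutCanonical`. Obstruction: (O1) no `IsNewformOf W f` instance in
the tree for any explicit `W`; (O2) no certified `[T^{r}]L_p ≠ 0`. Tried: zero datum on a rank-≥1
curve (paper refutation only). -/
theorem consistency_false_without_canonical : ¬ ConsistencyWithoutCanonical := by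
  sorry

/-- The crux with `IsOrdinaryAt W p` dropped. At a supersingular `p ≥ 5` of a rank-0 curve it
reads (by `unitRoot_eq_zero_of_dvd`, `padicLFunction_zero_root`, `Reg_p = 1`): `0 = q`, hence by
(A) `L(E,1) = 0` — false at `(32a2, p = 7)` (`a₇ = 0`, tree theorem
`frobeniusTrace_congruentNumberCurveInt`; `L(E₁,1) = 0.6555… ≠ 0`). [folklore] -/
def ConsistencyWithoutOrdinary : Prop :=
  ∀ (W : WeierstrassCurve ℚ) [W.IsElliptic] [W.IsGloballyMinimal] (p : ℕ) [Fact p.Prime], 5 ≤ p → ∀ (D : WeierstrassCurve.PAdicHeightData W p), D.IsCanonical → ∀ ⦃N : ℕ⦄ [NeZero N] (f : CuspForm (CongruenceSubgroup.Gamma0 N) 2), Literature.NumberTheory.EllipticCurves.ModularForms.IsNewformOf W f → 0 < W.regulator ∧ 0 < Literature.NumberTheory.EllipticCurves.ModularForms.plusPeriod f ∧ ∃ q : ℚ, iteratedDeriv W.mordellWeilRank W.entireLFunction 1 = (((W.mordellWeilRank.factorial : ℝ) * (q : ℝ) * Literature.NumberTheory.EllipticCurves.ModularForms.plusPeriod f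 * W.regulator : ℝ) : ℂ) ∧ PowerSeries.coeff W.mordellWeilRank (Literature.NumberTheory.EllipticCurves.padicLFunction f (Literature.NumberTheory.EllipticCurves.unitRoot W p : ℚ_[p])) * Literature.NumberTheory.EllipticCurves.padicLog p (Literature.NumberTheory.EllipticCurves.cyclotomicGenerator p) ^ W.mordellWeilRank = (q : ℚ_[p]) * (1 - (Literature.NumberTheory.EllipticCurves.unitRoot W p : ℚ_[p])⁻¹) ^ 2 * WeierstrassCurve.padicRegulator D

/-- NEAR-MISS: `¬ ConsistencyWithoutOrdinary`. Obstruction: (O1) needs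
`IsNewformOf (congruentNumberCurve 1) f` for an explicit `f` (the tree's `congruentCuspForm32` is
the candidate; its newform property is not proved); (O2′) needs
`(congruentNumberCurve 1).entireLFunction 1 ≠ 0` (Tunnell thread: `L(E₁,1) = β/4`, only behind
Waldspurger-type named facts). Everything else (`unitRoot = 0`, `L_p(f,0,T) = 0`, `Reg_p = 1`,
every `D` canonical, `p = 7` supersingular) is proved in this file / the tree. -/
theorem consistency_false_without_ordinary : ¬ ConsistencyWithoutOrdinary := by
  sorry

/-! ## §D  Numerics (paper evidence; kit job j020759, `compute/consistency_check2.gp`)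

PARI/GP 2.x, `msfromell` + `mspadicinit(·,p,n,0)` + `mspadicmoments` + `mspadicL(μ,0,r)` for
`L_p^{(r)}(χ⁰) = ∫_{ℤ_p^×} log_p(a)^r dμ(a)` (so `L_p^{(r)}(χ⁰)/r! = [T^r]L_p · log_p(γ)^r` when the
lower coefficients vanish — they do: column "lower"), `ellpadicregulator` (canonical height
`log_p(den x) − 2 log_p σ_{s₂}(P)`, Iwasawa `log_p`: the tree's `canonicalPAdicHeight` verbatim),
`ellL1(E,r)`, `ellheightmatrix`, `E.omega[1]`. CALIBRATION (rank 0): PARI's measure is normalised by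
`ω₁ = E.omega[1]`, NOT by `Ω_E = ω₁·#π₀(E(ℝ))`: `ρ := L_p(0)/((1−α⁻¹)²·L(E,1)/Ω_E) = 1` on 11a1
(`Δ < 0`, one component; p = 5, 7, 13) and `= 2` on 15a1 (`Δ > 0`, two components; p = 11, 13).
The tree's `Ω⁺_f = 2·gen(re Λ_f) = Ω_E` (both component conventions) for these optimal Manin-`1`
curves, so `L_p^{tree} = L_p^{PARI}/#π₀`. RESULT (`q_∞ := L^{(r)}(E,1)/(r!·Ω_E·Reg_∞)`,
`q_p := ([T^r]L_p^{tree}·log_p(γ)^r)/((1−α⁻¹)²·Reg_p)`, digits = p-adic precision reached):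

| curve | r | #π₀ | q_∞ | p : q_p^{PARI} → q_p^{tree} |
|---|---|---|---|---|
| 11a1 | 0 | 1 | 1/5 | 5, 7, 13 : ρ = 1 (interpolation exact) |
| 15a1 | 0 | 2 | 1/8 | 11, 13 : ρ = 2 → 1 |
| 37a1 | 1 | 2 | 1.00000000000 | 5: 2+O(5⁵) → 1 · 7: 2+O(7⁵) → 1 · 11: 2+O(11⁴) → 1 · 13: 2+O(13³) → 1 |
| 43a1 | 1 | 1 | 1.00000000000 | 5 (anomalous, v_p Reg_p = −1): 1+O(5⁵) · 11: 1+O(11⁴) · 13: 1+O(13⁴) |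
| 53a1 | 1 | 1 | 1.00000000000 | 7: 1+O(7⁵) · 13: 1+O(13⁴) |
| 389a1 | 2 | 2 | 1.00000000000 | 5: 2+O(5⁴) → 1 · 7: 2+O(7⁵) → 1 · 11: 2+O(11³) → 1 · 13: 2+O(13³) → 1 |
| 433a1 | 2 | 1 | 1.00000000000 | 5 (anomalous): 1+O(5⁴) · 7: 1+O(7⁵) · 11: 1+O(11³) · 13: 1+O(13²) |
| 5077a1 | 3 | 2 | 1.00000000000 | 5 (anomalous): 2+O(5³) → 1 (p = 7, 11, 13: PARI stack > 3.6 GB, not run) |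

In every case `q_p^{tree} = q_∞ = Tam/#tors²` (analytic `#Ш = 1`), i.e. the crux's identity
(A) ∧ (P) holds numerically with ONE rational `q`, at ranks 0, 1, 2, 3 — including the planner's
"cheapest falsifier" 389a1 at p = 5, 7 (and 11, 13). No normalisation slip between the crux's
`log_p(γ)^r`, `(1 − α⁻¹)²`, `Reg_p` (sigma height) and `Ω⁺_f` was detected; the only convention
trap found is EXTERNAL (PARI's `ω₁` versus the tree's `Ω⁺_f = Ω_E`), recorded here so that nobody
"refutes" the crux with un-renormalised PARI output (a factor `#π₀(E(ℝ)) = 2` when `Δ > 0`).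
-/

/-- Marker for §D (the evidence is the job log `compute-j020759.json` attached to
stmt-BirchSwinnertonDyer-16217 and the table in the module section above). -/
theorem numerics_marker : True := trivial

end Summit.BirchSwinnertonDyer.BirchSwinnertonDyer.Cruxes.Consistency.Disproof

end
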